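/-
Copyright (c) 2026 the pub-hodgecm-mathlib formalisation cell (harness21).  Prover seat hodgecm-mathlib-F0P2-p08 (g2), Track B «K2-LIT»,
#184♮ = hLiu418 = `stmt-HodgeConjecture-24832`; socket #41, KIND 1 «(K1b-W) KIND W AT RANK ONE FOR THE PULLED-BACK LINE FAMILY» (line lead K2Liu-p14 (g4) FILE CUT
2026-09-04T22:32:01Z, file (KW1-b); LEAD F0P6-plan (g14) BATCH #77 (1)).  THEOREMS ONLY (no `def`, no `instance`, no notation, no named-fact hypothesis, no `sorry`).
Edition 2 (prover seat hodgecm-mathlib-LH7-p08 (g2), LEAD BATCH #87 (3) ∕ #96, line lead K2Liu-p14 (g4) LINE WORD #1 (2)): §3 appended — holomorphy of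
`s ↦ (L^U(2s+1, ε))⁻¹` on `{0 < re s}` and the by-value `HasProd` forms; §1–§2 byte-identical.
-/
import Summits.HodgeConjecture.HodgeConjecture.Theorems.K2LiuSiegelEisensteinKindWLetters   -- ★ (x-a) p862483∕p862592: `kindWPlaces`, `kindWFinset`, off-`U` letters, `kindWPart` (+ ★ G1, ★ G2, ★ O41.6)
import HarnessLib

/-!
# Crux `HLiu418`, socket #41, KIND 1 ∕ (K1b-W) — `K2LiuKindOneLineWhittakerEuler`: THE RANK-ONE KIND-W EULER IDENTITY
# `W_μ(Φ_s)(x) = I_{U(μ,x)}(μ,s,x) · (L^{U(μ,x)}(2s+1, ε_{L∕L⁺}))⁻¹` ON `{0 < re s}`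

Cell `hodgecm-mathlib`, crux item hLiu418 = `stmt-HodgeConjecture-24832`, route of record `HCCMUnconditional`; squad K2 ∕ K2Liu, road `K2_Liu`, socket #41
`sig_K2LiuSiegelEisensteinContinuation`, KIND 1 («K1-b♮»: the rank-one Fourier coefficients through the pulled-back LINE families); line lead K2Liu-p14 (g4) FILE CUT
2026-09-04T22:32:01Z — (KW1-b) «(W1) at `n := 1` = ★ (x-a) §3 RE-RUN at `e₁` with the `n = 1` good-place letter `hJ₁`»; KIND-W byte desk F0P2-p08 (g2) 22:36:48Z «≠ on
consuming (x-a) §3 verbatim at `n = 1`: its Euler factor is the RANK-TWO `b`; the rank-one product is `L^U(2s+1, ε)`».  Lane `--supports stmt-HodgeConjecture-24832`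
(count-neutral helper; closes no socket by itself).
* §1 the RANK-ONE good-place Euler product: **`hasProd_lineFactor`** — `HasProd (v ∉ U ↦ 1 − ε(ϖ_v) q_v^{−(2s+1)}) (L^U(2s+1, ε))⁻¹` and `L^U(2s+1, ε) ≠ 0` for a unitary `ε`
  and `0 < re s` (★ `hasProd_partialStandardL_singleton` at `2s + 1`, inverted through `HasProd.inv₀` exactly as ★ G2 `hasProd_localFactor`); `tprod_lineFactor_eq`;
  the by-value Whittaker form **`tprod_lineWhittaker_of_vol_eq_one`** (`W v = 1 − ε(ϖ_v) q_v^{−(2s+1)}` off `U` ⇒ `∏'_{v∉U} W v = (L^U(2s+1, ε))⁻¹`); CM twin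
  `hasProd_lineFactor_cm` (`ε = ε_{L∕L⁺} = quadraticHeckeCharCM L`).
* §2 **`whittakerDelta_eq_kindWPart_mul_line`** — ★ G1 `whittakerDelta_eq_mul_tprod_euler` at `T := kindWFinset T₀ μ x` (★ (x-a) §1 letters) × §1 at `U := kindWPlaces ↑T₀ μ x`,
  fed by the rank-one per-place letter `hJ`; frame binders GENERIC (`e dV hdV dW hdW`; the line = `e₁ := Equiv.prodUnique (Fin 1) (Fin 1)`, `dV = dW = 1`).
* §3 (edition 2, LH7-p08 (g2)) **`differentiableOn_inv_lineL`** — `s ↦ (L^U(2s+1, ε))⁻¹` is holomorphic on `{0 < re s}` (★ `differentiableOn_partialStandardL_singleton` on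
  `Re > 1` composed with `s ↦ 2s+1`, zero-free there by §1; the rank-one twin of ★ G2 `differentiableOn_inv_b`, the holomorphy the K1-b♮ assembly pays `GW` with) + CM twin
  `differentiableOn_inv_lineL_cm`; `multipliable_lineFactor`; the BY-VALUE `HasProd` forms `hasProd_lineWhittaker_div_vol` (un-normalised `ν_v`: `W v = m v·(1 − ε(ϖ_v)q_v^{−(2s+1)})`,
  volumes `m v ≠ 0`) and `hasProd_lineWhittaker_of_vol_eq_one`; `tprod_lineWhittaker_of_vol_eq_one_cm`.
NOT HERE: the per-place discharge of `hJ` (★ rank-one∕E1 `W2-fin` closed forms at a `μ`-unit good place), `hG` (the line family's big-cell majorant, (KW1-a)), the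
continued letter and the (KW1-f) package.
HONEST LABEL.  Count-neutral helper; it retires nothing by itself: `HC_CM` is proved only modulo the 7 printed citations (2 remaining named inputs:
hLiu418 = `stmt-HodgeConjecture-24832`, h413 = `stmt-HodgeConjecture-24833`) until rung 0 closes.

## References
* [KudlaRallis1994] S. Kudla, S. Rallis, Ann. of Math. 140 (1994): §1.   * [Tan1999] V. Tan, Canad. J. Math. 51 (1999): §2–§3.
* [Liu2011] Y. Liu, Algebra Number Theory 5 (2011): §2A (2-10) (`W_T(e, φ°) = 1∕b` at unimodular `T`; rank one: `b₁(s) = L(2s+1, ε)`).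
* [NeukirchANT1999] J. Neukirch, *Algebraic Number Theory* (1999): Ch. VII §8 (absolute convergence of Hecke `L`-series on `Re > 1`).
* [CasselsFrohlichANT1967] Cassels–Fröhlich (eds.), *Algebraic Number Theory* (1967): Ch. XV (Tate) Thm. 3.3.1.
-/

set_option autoImplicit false
-- the mandated namespace repeats the single-problem summit's segment (`HodgeConjecture.HodgeConjecture`)
set_option linter.dupNamespace false

noncomputable section

open scoped Matrix RestrictedProduct ENNReal NNReal Topology ComplexConjugate
open NumberField IsDedekindDomain MeasureTheory Measure Filter Set

namespace Summit.HodgeConjecture.HodgeConjecture.Cruxes.HLiu418.K2LiuKindOneLineWhittakerEuler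

open Literature.NumberTheory.Automorphic Literature.NumberTheory.GaloisRepresentations Literature.NumberTheory.LFunctions
open Literature.NumberTheory.GelbartRogawski1991 Literature.NumberTheory.GelbartRogawski1991.GRConstruction
open Literature.NumberTheory.K2Lit.SiegelDoubled
open Literature.NumberTheory.K2Lit.PlaceSplitting
open Literature.MeasureTheory.RestrictedProduct
open Literature.Topology.Algebra.RestrictedProduct (inH)
open Summit.HodgeConjecture.HodgeConjecture.Cruxes.HLiu418.K2LiuSiegelUnipotentLocalDefs
open Summit.HodgeConjecture.HodgeConjecture.Cruxes.HLiu418.K2LiuSiegelUnipotentSplitDefs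
open Summit.HodgeConjecture.HodgeConjecture.Cruxes.HLiu418.K2LiuSiegelUnipotentSplitAtDefs
open Summit.HodgeConjecture.HodgeConjecture.Cruxes.HLiu418.K2LiuSiegelUnipotentHaarPinned
open Summit.HodgeConjecture.HodgeConjecture.Cruxes.HLiu418.K2LiuSiegelUnipotentEulerProduct
open Summit.HodgeConjecture.HodgeConjecture.Cruxes.HLiu418.K2LiuSiegelUnipotentFourierDefs
open Summit.HodgeConjecture.HodgeConjecture.Cruxes.HLiu418.K2LiuWhittakerDeltaEulerHead
open Summit.HodgeConjecture.HodgeConjecture.Cruxes.HLiu418.K2LiuWhittakerDeltaEulerProduct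
open Summit.HodgeConjecture.HodgeConjecture.Cruxes.HLiu418.K2LiuSiegelIntertwiningScalarGL1
open Summit.HodgeConjecture.HodgeConjecture.Cruxes.H413.F0P2wPartialDedekindZetaPole (hasProd_partialStandardL_singleton)
open Summit.HodgeConjecture.HodgeConjecture.Cruxes.HLiu418.K2LiuSiegelEisensteinKindWLetters

/-! ## §1 The rank-one good-place Euler product `∏'_{v∉U} (1 − ε(ϖ_v) q_v^{−(2s+1)}) = (L^U(2s+1, ε))⁻¹` -/

section LineFactor

variable {F : Type} [Field F] [NumberField F] {ε : HeckeCharacter F} {U : Set (HeightOneSpectrum (𝓞 F))}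

/-- **THE RANK-ONE GOOD-PLACE EULER FACTOR**: for a unitary Hecke character `ε`, any set `U` of finite places and `0 < re s`, the local factors
`1 − ε(ϖ_v) q_v^{−(2s+1)}` have `HasProd` over `v ∉ U` equal to `(L^U(2s+1, ε))⁻¹`, and `L^U(2s+1, ε) ≠ 0` (★ `hasProd_partialStandardL_singleton` at `2s+1`, `re > 1`,
inverted: partial products of inverses are inverses of partial products). [cite: Liu2011, §2A (2-10)] [cite: NeukirchANT1999, Ch. VII §8] -/
theorem hasProd_lineFactor (hε : ε.IsUnitary) {s : ℂ} (hs : 0 < s.re) :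
    HasProd (fun v : {v : HeightOneSpectrum (𝓞 F) // v ∉ U} => 1 - ε.valueAtUniformizer v.1 * (v.1.residueCard : ℂ) ^ (-(2 * s + 1)))
      (partialStandardL U (fun v => {ε.valueAtUniformizer v}) (2 * s + 1))⁻¹ ∧
    partialStandardL U (fun v => {ε.valueAtUniformizer v}) (2 * s + 1) ≠ 0 := by
  obtain ⟨-, -, h2p1, -⟩ := re_two_mul_shifts s
  obtain ⟨hL, hL0⟩ := hasProd_partialStandardL_singleton (S := U) (fun v => ε.valueAtUniformizer v)
    (norm_valueAtUniformizer_le_one hε U) (s := 2 * s + 1) (by rw [h2p1]; linarith)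
  refine ⟨?_, hL0⟩
  have hinv : HasProd (fun v : {v : HeightOneSpectrum (𝓞 F) // v ∉ U} =>
      ((1 - ε.valueAtUniformizer v.1 * (v.1.residueCard : ℂ) ^ (-(2 * s + 1)))⁻¹)⁻¹)
      (partialStandardL U (fun v => {ε.valueAtUniformizer v}) (2 * s + 1))⁻¹ := by
    unfold HasProd at hL ⊢
    simpa only [Finset.prod_inv_distrib] using hL.inv₀ hL0
  refine hinv.congr_fun fun v => ?_
  rw [inv_inv]

/-- `tprod` form: `∏'_{v∉U} (1 − ε(ϖ_v) q_v^{−(2s+1)}) = (L^U(2s+1, ε))⁻¹`, `0 < re s`. [cite: Liu2011, §2A (2-10)] -/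
theorem tprod_lineFactor_eq (hε : ε.IsUnitary) {s : ℂ} (hs : 0 < s.re) :
    ∏' v : {v : HeightOneSpectrum (𝓞 F) // v ∉ U}, (1 - ε.valueAtUniformizer v.1 * (v.1.residueCard : ℂ) ^ (-(2 * s + 1))) =
      (partialStandardL U (fun v => {ε.valueAtUniformizer v}) (2 * s + 1))⁻¹ :=
  (hasProd_lineFactor hε hs).1.tprod_eq

/-- **by-value Whittaker form** (`ν_v`-normalised local integrals): if `W v = 1 − ε(ϖ_v) q_v^{−(2s+1)}` off `U`, then `∏'_{v∉U} W v = (L^U(2s+1, ε))⁻¹`.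
[cite: Liu2011, §2A (2-10)] [cite: Tan1999, §2] -/
theorem tprod_lineWhittaker_of_vol_eq_one (hε : ε.IsUnitary) {s : ℂ} (hs : 0 < s.re) {W : HeightOneSpectrum (𝓞 F) → ℂ}
    (hW : ∀ v, v ∉ U → W v = 1 - ε.valueAtUniformizer v * (v.residueCard : ℂ) ^ (-(2 * s + 1))) :
    ∏' v : {v : HeightOneSpectrum (𝓞 F) // v ∉ U}, W v.1 = (partialStandardL U (fun v => {ε.valueAtUniformizer v}) (2 * s + 1))⁻¹ :=
  ((hasProd_lineFactor hε hs).1.congr_fun fun v => hW v.1 v.2).tprod_eq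

end LineFactor

/-- **CM twin** (`F = L⁺`, `ε = ε_{L∕L⁺}`): `HasProd (v ∉ U ↦ 1 − ε(ϖ_v) q_v^{−(2s+1)}) (L^U(2s+1, ε_{L∕L⁺}))⁻¹` and non-vanishing, `0 < re s`.
[cite: Liu2011, §2A (2-10)] -/
theorem hasProd_lineFactor_cm (L : Type) [Field L] [NumberField L] [IsCMField L] {U : Set (HeightOneSpectrum (𝓞 ↥(maximalRealSubfield L)))}
    {s : ℂ} (hs : 0 < s.re) :
    HasProd (fun v : {v : HeightOneSpectrum (𝓞 ↥(maximalRealSubfield L)) // v ∉ U} =>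
        1 - (quadraticHeckeCharCM L).valueAtUniformizer v.1 * (v.1.residueCard : ℂ) ^ (-(2 * s + 1)))
      (partialStandardL U (fun v => {(quadraticHeckeCharCM L).valueAtUniformizer v}) (2 * s + 1))⁻¹ ∧
    partialStandardL U (fun v => {(quadraticHeckeCharCM L).valueAtUniformizer v}) (2 * s + 1) ≠ 0 :=
  hasProd_lineFactor (Literature.RepresentationTheory.HarrisKudlaSweet1996.isFiniteOrder_quadraticHeckeCharCM (L := L)).isUnitary hs

/-! ## §2 (W1) at rank one: `W_μ(Φ_s)(x) = I_{U(μ,x)}(μ,s,x) · (L^U(2s+1, ε_{L∕L⁺}))⁻¹` -/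

section Euler

variable (L : Type) [Field L] [NumberField L] [IsCMField L]
variable {N M n : ℕ} (e : Fin N × Fin M ≃ Fin n)
  (dV : Fin N → L) (hdV : ∀ i, IsCMField.complexConj L (dV i) = dV i)
  (dW : Fin M → L) (hdW : ∀ i, IsCMField.complexConj L (dW i) = dW i)
  [DecidableEq (HeightOneSpectrum (𝓞 (Fp L)))]
  [MeasurableSpace ↥(unipDelta L e dV hdV dW hdW)] [BorelSpace ↥(unipDelta L e dV hdV dW hdW)]
  [MeasurableSpace ↥(unipDeltaArch L e dV hdV dW hdW)] [BorelSpace ↥(unipDeltaArch L e dV hdV dW hdW)]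
  [∀ v : HeightOneSpectrum (𝓞 (Fp L)), MeasurableSpace ↥(unipDeltaLoc L e dV hdV dW hdW v)] [∀ v : HeightOneSpectrum (𝓞 (Fp L)), BorelSpace ↥(unipDeltaLoc L e dV hdV dW hdW v)]

set_option maxHeartbeats 800000 in -- MEASURED (as ★ (x-a) §3 `whittakerDelta_eq_kindWPart_mul` ∕ ★ G1, whose statement this one repeats: default 200 000 times out at `whnf` of the statement); plain `rw`, no search tactics
/-- **(W1) AT RANK ONE — `W_μ(Φ_s)(x) = I_{U(μ,x)}(μ,s,x) · (L^U(2s+1, ε_{L∕L⁺}))⁻¹`, `U = U(μ,x)`** (the KIND-W Euler identity for the doubled LINE, (K1b-W) of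
K2Liu-p14 (g4)'s cut; stated for generic frame binders `e dV hdV dW hdW` and applied at `e₁ = Equiv.prodUnique (Fin 1) (Fin 1)`).  INPUTS: ★ G1's Whittaker–Euler data
specification for every finite `T` (`hνK`, `hmap`, `hfac` off `T₀`), `χ` unramified off `T₀`, `0 < re s` (`s` = the family's own parameter), the integrability `hG` of the
global Whittaker integrand, and ONE per-place letter `hJ` off `U(μ,x)` in RANK-ONE currency: `∫ conj ψ_μ(ι_v y)·Λ_{s,v}((w_Δ)_v y) dν_v = 1 − ε(ϖ_v) q_v^{−(2s+1)}`
(★ rank-one ∕ E1 closed forms, by value here).  PROOF: ★ G1 `whittakerDelta_eq_mul_tprod_euler` at `T := kindWFinset T₀ μ x` (letters `hh hw hS hχ` from ★ (x-a) §1) and §1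
`tprod_lineWhittaker_of_vol_eq_one` at `U := kindWPlaces ↑T₀ μ x`.
[cite: KudlaRallis1994, §1] [cite: Tan1999, §2–§3] [cite: Liu2011, §2A (2-10)] [cite: CasselsFrohlichANT1967, Ch. XV Thm. 3.3.1] -/
theorem whittakerDelta_eq_kindWPart_mul_line (T₀ : Finset (HeightOneSpectrum (𝓞 (Fp L))))
    (νN : Measure ↥(unipDelta L e dV hdV dW hdW))
    (νv : ∀ v : HeightOneSpectrum (𝓞 (Fp L)), Measure ↥(unipDeltaLoc L e dV hdV dW hdW v)) [∀ v, (νv v).IsHaarMeasure] [∀ v, SigmaFinite (νv v)]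
    (hνK : ∀ v, νv v (((inH (fun v => UnitaryGroup.localInt L (IsCMField.complexConj L) (n + n) (hermD L e dV hdV dW hdW) v)
      (fun v => unipDeltaLoc L e dV hdV dW hdW v) v) : Subgroup ↥(unipDeltaLoc L e dV hdV dW hdW v)) : Set ↥(unipDeltaLoc L e dV hdV dW hdW v)) = 1)
    (νinf : Finset (HeightOneSpectrum (𝓞 (Fp L))) → Measure ↥(unipDeltaArch L e dV hdV dW hdW)) (hσ : ∀ T, SigmaFinite (νinf T))
    (hmap : ∀ T : Finset (HeightOneSpectrum (𝓞 (Fp L))), Measure.map (unipDeltaSplitAt L e dV hdV dW hdW T) νN =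
      (νinf T).prod ((Measure.pi fun v : T => νv v.1).prod
        (rpMeasure (fun v : {v : HeightOneSpectrum (𝓞 (Fp L)) // v ∉ T} => ((inH (fun v => UnitaryGroup.localInt L (IsCMField.complexConj L) (n + n) (hermD L e dV hdV dW hdW) v)
          (fun v => unipDeltaLoc L e dV hdV dW hdW v) v.1 : Subgroup ↥(unipDeltaLoc L e dV hdV dW hdW v.1)) : Set ↥(unipDeltaLoc L e dV hdV dW hdW v.1))) (fun v => νv v.1) ∅)))
    {χ : HeckeCharacter L} (hχ : ∀ v, v ∉ T₀ → ∀ w' : UnitaryGroup.PlacesOver L v, χ.IsUnramifiedAt w'.1)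
    {f : ℂ → HA L e dV hdV dW hdW → ℂ}
    {fT : ∀ T : Finset (HeightOneSpectrum (𝓞 (Fp L))), ℂ → UnitaryGroup.arch (Fp L) L (IsCMField.complexConj L) (n + n) (hermD L e dV hdV dW hdW) ×
      (Π v : T, UnitaryGroup.localPi L (IsCMField.complexConj L) (n + n) (hermD L e dV hdV dW hdW) v.1) → ℂ}
    (hfac : ∀ T : Finset (HeightOneSpectrum (𝓞 (Fp L))), T₀ ⊆ T → IsFactorizableOff L e dV hdV dW hdW T χ f (fT T))
    (S : Matrix (Fin n) (Fin n) L) {s : ℂ} (hs : 0 < s.re) (h : HA L e dV hdV dW hdW)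
    (hG : Integrable (fun u : ↥(unipDelta L e dV hdV dW hdW) =>
      conj (unipDeltaChar L e dV hdV dW hdW S (u : HA L e dV hdV dW hdW) : ℂ) * f s (weylDelta L e dV hdV dW hdW * (u : HA L e dV hdV dW hdW) * h)) νN)
    (hJ : ∀ v, v ∉ kindWPlaces L e dV hdV dW hdW (T₀ : Set (HeightOneSpectrum (𝓞 (Fp L)))) S h →
      ∫ y, conj (unipDeltaChar L e dV hdV dW hdW S
            (locToAdelic L e dV hdV dW hdW v (y : UnitaryGroup.localPi L (IsCMField.complexConj L) (n + n) (hermD L e dV hdV dW hdW) v)) : ℂ) *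
          LambdaLoc L e dV hdV dW hdW v χ s
            (UnitaryGroup.evalPlace (Fp L) L (IsCMField.complexConj L) (n + n) (hermD L e dV hdV dW hdW) v
                (UnitaryGroup.finPart (Fp L) L (IsCMField.complexConj L) (n + n) (hermD L e dV hdV dW hdW) (weylDelta L e dV hdV dW hdW)) *
              (y : UnitaryGroup.localPi L (IsCMField.complexConj L) (n + n) (hermD L e dV hdV dW hdW) v)) ∂(νv v) =
        1 - (quadraticHeckeCharCM L).valueAtUniformizer v * (v.residueCard : ℂ) ^ (-(2 * s + 1))) :
    whittakerDelta L e dV hdV dW hdW νN S (f s) h =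
      kindWPart L e dV hdV dW hdW (kindWFinset L e dV hdV dW hdW T₀ S h) (νinf (kindWFinset L e dV hdV dW hdW T₀ S h)) νv
          (fT (kindWFinset L e dV hdV dW hdW T₀ S h)) S s h *
        (partialStandardL (kindWPlaces L e dV hdV dW hdW (T₀ : Set (HeightOneSpectrum (𝓞 (Fp L)))) S h)
            (fun v => {(quadraticHeckeCharCM L).valueAtUniformizer v}) (2 * s + 1))⁻¹ := by
  -- ★ G1 at `T := U(S,h)` (as a `Finset`), its letters `hh hw hS hχ` read off §1
  have hout : ∀ v, v ∉ kindWFinset L e dV hdV dW hdW T₀ S h → v ∉ kindWPlaces L e dV hdV dW hdW (T₀ : Set (HeightOneSpectrum (𝓞 (Fp L)))) S h :=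
    fun v hv hv' => hv ((mem_kindWFinset L e dV hdV dW hdW).2 hv')
  haveI := hσ (kindWFinset L e dV hdV dW hdW T₀ S h)
  obtain ⟨-, hW⟩ := whittakerDelta_eq_mul_tprod_euler L e dV hdV dW hdW (kindWFinset L e dV hdV dW hdW T₀ S h) νN νv (fun v _ => hνK v)
    (νinf (kindWFinset L e dV hdV dW hdW T₀ S h)) (hmap _)
    (fun v hv => hχ v fun hv' => not_mem_of_not_mem_kindWPlaces L e dV hdV dW hdW (hout v hv) (Finset.mem_coe.2 hv'))
    (hfac _ (subset_kindWFinset L e dV hdV dW hdW T₀ S h)) s S (h := h)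
    (fun v hv => evalPlace_mem_localInt_of_not_mem_kindWPlaces L e dV hdV dW hdW (hout v hv))
    (fun v hv => weylDelta_mem_localInt_of_not_mem_kindWPlaces L e dV hdV dW hdW (hout v hv))
    (fun v hv w i j => integral_of_not_mem_kindWPlaces L e dV hdV dW hdW (hout v hv) w i j) hG
  -- ★ G2 at `U := ↑(kindWFinset T₀ S h) = U(S,h)`, fed by the per-place letter `hJ`
  have hE := tprod_lineWhittaker_of_vol_eq_one (U := ((kindWFinset L e dV hdV dW hdW T₀ S h : Finset (HeightOneSpectrum (𝓞 (Fp L)))) : Set (HeightOneSpectrum (𝓞 (Fp L)))))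
    (Literature.RepresentationTheory.HarrisKudlaSweet1996.isFiniteOrder_quadraticHeckeCharCM (L := L)).isUnitary hs
    (W := fun v => ∫ y, conj (unipDeltaChar L e dV hdV dW hdW S
            (locToAdelic L e dV hdV dW hdW v (y : UnitaryGroup.localPi L (IsCMField.complexConj L) (n + n) (hermD L e dV hdV dW hdW) v)) : ℂ) *
          LambdaLoc L e dV hdV dW hdW v χ s
            (UnitaryGroup.evalPlace (Fp L) L (IsCMField.complexConj L) (n + n) (hermD L e dV hdV dW hdW) v
                (UnitaryGroup.finPart (Fp L) L (IsCMField.complexConj L) (n + n) (hermD L e dV hdV dW hdW) (weylDelta L e dV hdV dW hdW)) *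
              (y : UnitaryGroup.localPi L (IsCMField.complexConj L) (n + n) (hermD L e dV hdV dW hdW) v)) ∂(νv v))
    (fun v hv => hJ v fun hv' => hv (Finset.mem_coe.2 ((mem_kindWFinset L e dV hdV dW hdW).2 hv')))
  rw [hW, ← coe_kindWFinset L e dV hdV dW hdW T₀ S h, ← hE]
  rfl


end Euler

/-! ## §3 (edition 2) Holomorphy of `s ↦ (L^U(2s+1, ε))⁻¹` on `{0 < re s}` and the by-value `HasProd` forms -/

section LineFactorHolomorphy

open Summit.HodgeConjecture.HodgeConjecture.Cruxes.H413.F0P2wPartialDedekindZetaPole (differentiableOn_partialStandardL_singleton)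

variable {F : Type} [Field F] [NumberField F] {ε : HeckeCharacter F} {U : Set (HeightOneSpectrum (𝓞 F))}

/-- `Multipliable` form of `hasProd_lineFactor`: the rank-one good-place factors `1 − ε(ϖ_v) q_v^{−(2s+1)}` are multipliable over `v ∉ U` for `0 < re s`.
[cite: Liu2011, §2A (2-10)] [cite: NeukirchANT1999, Ch. VII §8] -/
theorem multipliable_lineFactor (hε : ε.IsUnitary) {s : ℂ} (hs : 0 < s.re) :
    Multipliable (fun v : {v : HeightOneSpectrum (𝓞 F) // v ∉ U} =>
        (1 - ε.valueAtUniformizer v.1 * (v.1.residueCard : ℂ) ^ (-(2 * s + 1)))) :=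
  (hasProd_lineFactor hε hs).1.multipliable

/-- **`∏'_{v∉U} W_{μ,v}(1,s) ∕ m_v = (L^U(2s+1, ε))⁻¹`, BY VALUE, un-normalised local measures.**  If off `U` the numbers `W v` and the volumes `m v ≠ 0` satisfy the
rank-one good-place letter `W v = m v · (1 − ε(ϖ_v) q_v^{−(2s+1)})` (`m v = ν_v(K_{H,v} ∩ N_Δ(L⁺_v))`), then `HasProd (v ∉ U ↦ W v ∕ m v) (L^U(2s+1, ε))⁻¹`, `0 < re s`
(the rank-one twin of ★ G2 `hasProd_whittaker_div_vol`). [cite: KudlaRallis1994, §1] [cite: Liu2011, §2A (2-10)] -/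
theorem hasProd_lineWhittaker_div_vol (hε : ε.IsUnitary) {s : ℂ} (hs : 0 < s.re) {W : HeightOneSpectrum (𝓞 F) → ℂ} {m : HeightOneSpectrum (𝓞 F) → ℝ}
    (hm : ∀ v, v ∉ U → m v ≠ 0)
    (hW : ∀ v, v ∉ U → W v = (m v : ℂ) * (1 - ε.valueAtUniformizer v * (v.residueCard : ℂ) ^ (-(2 * s + 1)))) :
    HasProd (fun v : {v : HeightOneSpectrum (𝓞 F) // v ∉ U} => W v.1 / (m v.1 : ℂ))
      (partialStandardL U (fun v => {ε.valueAtUniformizer v}) (2 * s + 1))⁻¹ := by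
  refine (hasProd_lineFactor hε hs).1.congr_fun fun v => ?_
  have hm0 : (m v.1 : ℂ) ≠ 0 := by exact_mod_cast hm v.1 v.2
  rw [hW v.1 v.2, mul_div_cancel_left₀ _ hm0]

/-- **normalised `HasProd` twin** (`ν_v(K_{H,v} ∩ N_Δ(L⁺_v)) = 1` off `U`): `HasProd (v ∉ U ↦ W v) (L^U(2s+1, ε))⁻¹` whenever `W v = 1 − ε(ϖ_v) q_v^{−(2s+1)}` off `U`,
`0 < re s` (the `HasProd` behind §1 `tprod_lineWhittaker_of_vol_eq_one`). [cite: KudlaRallis1994, §1] [cite: Tan1999, §2] -/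
theorem hasProd_lineWhittaker_of_vol_eq_one (hε : ε.IsUnitary) {s : ℂ} (hs : 0 < s.re) {W : HeightOneSpectrum (𝓞 F) → ℂ}
    (hW : ∀ v, v ∉ U → W v = 1 - ε.valueAtUniformizer v * (v.residueCard : ℂ) ^ (-(2 * s + 1))) :
    HasProd (fun v : {v : HeightOneSpectrum (𝓞 F) // v ∉ U} => W v.1)
      (partialStandardL U (fun v => {ε.valueAtUniformizer v}) (2 * s + 1))⁻¹ :=
  (hasProd_lineFactor hε hs).1.congr_fun fun v => hW v.1 v.2

/-- **`s ↦ (L^U(2s+1, ε))⁻¹` IS HOLOMORPHIC ON `{0 < re s}`** — the rank-one twin of ★ G2 `differentiableOn_inv_b` (`L^U(·, ε)` is holomorphic on `Re > 1`, ★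
`differentiableOn_partialStandardL_singleton`, composed with the affine map `s ↦ 2s+1`; zero-free there by §1 `hasProd_lineFactor`).  This is the holomorphy of the
rank-one `GW`-factor on the K1-b♮ window. [cite: NeukirchANT1999, Ch. VII §8] [cite: Liu2011, §2A (2-10)] -/
theorem differentiableOn_inv_lineL (hε : ε.IsUnitary) :
    DifferentiableOn ℂ (fun s : ℂ => (partialStandardL U (fun v => {ε.valueAtUniformizer v}) (2 * s + 1))⁻¹) {s : ℂ | 0 < s.re} := by
  have h : DifferentiableOn ℂ (fun s : ℂ => partialStandardL U (fun v => {ε.valueAtUniformizer v}) (2 * s + 1)) {s : ℂ | 0 < s.re} :=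
    (differentiableOn_partialStandardL_singleton _ (norm_valueAtUniformizer_le_one hε U)).comp
      (((differentiableOn_const _).mul differentiableOn_id).add (differentiableOn_const _))
      fun s hs => by
        have hs' : 0 < s.re := hs
        show 1 < (2 * s + 1).re
        rw [(re_two_mul_shifts s).2.2.1]; linarith
  exact h.inv fun s hs => (hasProd_lineFactor (U := U) hε hs).2

end LineFactorHolomorphy

section CMHolomorphy

variable (L : Type) [Field L] [NumberField L] [IsCMField L]

/-- **CM twin, normalised by-value form**: `∏'_{v∉U} W v = (L^U(2s+1, ε_{L∕L⁺}))⁻¹` whenever `W v = 1 − ε(ϖ_v) q_v^{−(2s+1)}` off `U`, `0 < re s`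
(`ε = quadraticHeckeCharCM L`, unitary of finite order). [cite: KudlaRallis1994, §1] [cite: Liu2011, §2A (2-10)] -/
theorem tprod_lineWhittaker_of_vol_eq_one_cm {U : Set (HeightOneSpectrum (𝓞 ↥(maximalRealSubfield L)))} {s : ℂ} (hs : 0 < s.re)
    {W : HeightOneSpectrum (𝓞 ↥(maximalRealSubfield L)) → ℂ}
    (hW : ∀ v, v ∉ U → W v = 1 - (quadraticHeckeCharCM L).valueAtUniformizer v * (v.residueCard : ℂ) ^ (-(2 * s + 1))) :
    ∏' v : {v : HeightOneSpectrum (𝓞 ↥(maximalRealSubfield L)) // v ∉ U}, W v.1 =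
      (partialStandardL U (fun v => {(quadraticHeckeCharCM L).valueAtUniformizer v}) (2 * s + 1))⁻¹ :=
  tprod_lineWhittaker_of_vol_eq_one (Literature.RepresentationTheory.HarrisKudlaSweet1996.isFiniteOrder_quadraticHeckeCharCM (L := L)).isUnitary hs hW

/-- **CM twin of the holomorphy**: `s ↦ (L^U(2s+1, ε_{L∕L⁺}))⁻¹` is holomorphic on `{0 < re s}` (`ε = quadraticHeckeCharCM L`). [cite: NeukirchANT1999, Ch. VII §8] -/
theorem differentiableOn_inv_lineL_cm {U : Set (HeightOneSpectrum (𝓞 ↥(maximalRealSubfield L)))} :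
    DifferentiableOn ℂ (fun s : ℂ =>
      (partialStandardL U (fun v => {(quadraticHeckeCharCM L).valueAtUniformizer v}) (2 * s + 1))⁻¹) {s : ℂ | 0 < s.re} :=
  differentiableOn_inv_lineL (Literature.RepresentationTheory.HarrisKudlaSweet1996.isFiniteOrder_quadraticHeckeCharCM (L := L)).isUnitary

end CMHolomorphy

end Summit.HodgeConjecture.HodgeConjecture.Cruxes.HLiu418.K2LiuKindOneLineWhittakerEuler

end
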